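import Summits.HodgeConjecture.HodgeConjecture.Cruxes.BlochSeedDiscOne.SigmaH
import Summits.HodgeConjecture.HodgeConjecture.Cruxes.BlochSeedDiscOne.MinMassWindowH14
import Summits.HodgeConjecture.HodgeConjecture.Cruxes.BlochSeedDiscOne.AxisPhaseTorus
import Summits.HodgeConjecture.HodgeConjecture.Cruxes.BlochSeedDiscOne.PhaseTorusLawN13
import Summits.HodgeConjecture.HodgeConjecture.Cruxes.BlochSeedDiscOne.PhaseTorusLawN14

/-!
line stmt-HodgeConjecture-18881 Cruxes/BlochSeedDiscOne/Lines/birth.lean 814a6a70c14e831a stub_rung_pad4_seedAt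

# AxisRoomInhabitant24 — REALISABILITY IS FREE: the corank-14 torus witness `ω₁₄` IS the class measure of an explicit (A1)-clean
# AXIS design `D⋆` of rank 24 with `HallUp`, `HallPlusUp 8`, `Disj`, `μ = 32 ≠ 0`, 56 copies and Σ-budget to spare — and `¬ RuleD`
(plan-lens-HodgeAV-strengthen g21, 2026-08-31; STRENGTHEN-MEMO-31; answers the NAMED GAP of memo-30 §4 ∕ S⁺-ledger rows #208 #214 and
director-hodge g30 «r ≥ 22 is REALISABILITY»)

HONESTY LABEL.  Letter-model statements about `DepthBoundA4.Design` only (Chern-character words on a letter model ≠ sheaves ≠ monads ≠ a SEED).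
NOTHING here is proved toward HC ∕ HC_CM ∕ HC_AV ∕ №4 ∕ 26512 ∕ 18881 ∕ H2; no rung, no shell of `SPlus 14 sigmaH 0` is closed; this is
kernel-checked EVIDENCE for the strengthen lens (which S⁺ can still be true, and which binder of the door of record carries it).
CENSUS-NEUTRAL: `D⋆` FAILS the door of record (`RuleD`, certified below), so it inhabits nothing of record.

THE DESIGN `D⋆ = D⋆(24)` (§2), height 14: N-side `24·(14;0,0)⁴` plus the 14 positive phases of `PhaseTorusLawN14.omega14Z` realised as
co-level-1 AXIS cells `(13; i^{τ_f})_f` with multiplicities `wt14` (mass 16); P-side the 16 negative phases realised likewise (mass 16).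
KERNEL CERTIFICATE (§3–§4, `decide +kernel` on closed terms, boiler-plate of `MinMassWindowH14` §0–§1 by import):
`OnAlphabet 14`, `AxisRoom`, `Disj`, `(A1)` with e-free rows EXACTLY `24·14^deg` and mixed rows `0`, `μ = T(eeee) = T(ēēēē) = 32`,
`rank = 24`, `copies = 56`, `HallUp`, `HallPlusUp 8` (the hub entry alone covers: `16 + 8 ≤ 24`) and it is TIGHT (`¬ HallPlusUp 9`),
`Σ-H = 28·56 = 1568`, `BudgetClause sigmaH 0` (`1568 + 28·20 = 2128 ≤ 3136`), `omegaC D⋆ = omega14Z` pointwise (so `#posCl = 14`: the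
inhabitant-shape bound `#posCl + 8 ≤ rank` of `AxisPhaseTorus` reads `22 ≤ 24`), and `¬ RuleD` (no charged N-cell has a supplier on any block:
all P-cells sit at the same level).  §5 transports `D⋆` to EVERY height `h ≥ 1` (`HeightTower.shiftD`).

WHAT IT SETTLES (S⁺-ledger v1.44 rows #216–#221).
* `AxisLaw r := ∀ h D, OnAlphabet h → AxisRoom → (A1) → HallPlusUp 8 → rank ≤ r → μ = 0` holds at `r = 21` (`axisLaw_21`, = g20's
  `axisRoom_mu_eq_zero_21`) and FAILS at every `r ≥ 24` (`not_axisLaw_of_ge_24`): the exact threshold of the RULE-D-free axis-room law is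
  `r⋆ ∈ {21, 22, 23}` (`axisLaw_window`).  REALISABILITY of a law-violating class measure by an (A1)-clean Hall design — the input named
  in memo-29 §5, memo-30 §4, rows #208 #214 and by director-hodge g30 — is FREE (§4 `omegaC_D`), so it is NOT an obstruction and cannot be
  the non-torus input that lifts `21`.
* In the axis room EVERY binder of the statement of record `RuleDPlate.SPlus 14 sigmaH 0` except `RuleD` is jointly satisfiable
  (`not_ruleDfree_door_axisRoom`, every height `h ≥ 1`, with the Σ-budget of record and a fortiori budget-free): above rank 21 the axis-room
  door is carried by `RuleD` ALONE.  The next S⁺ of this road must use `RuleD` (LeggedFloor's hub corners) — memo-31 §3 states it with the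
  complete level-free (A1) dictionary of the axis room (the MARGINAL TORUS SYSTEM).
PROVENANCE (irrelevant to validity): g21 `eng/dstar.py` (stdlib Python, exact integers: (A1) over 5⁴ words, μ, Hall by brute force over 2¹⁶
column sets, RuleD, Σ-H digits) → `eng/emit_lean.py` → this file.  `decide +kernel` only: no `native_decide`, no `sorry`, no `axiom`, no
`instance`, no notation, no Literature fact, no `allowUnsafeReducibility`.
-/

set_option linter.dupNamespace false
set_option autoImplicit false
set_option maxRecDepth 16384
set_option maxHeartbeats 8000000

namespace Summit.HodgeConjecture.HodgeConjecture.Cruxes.BlochSeedDiscOne.AxisRoomInhabitant24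

open Summit.HodgeConjecture.HodgeConjecture.Cruxes.BlochSeedDiscOne.DepthBoundA4
open Summit.HodgeConjecture.HodgeConjecture.Cruxes.BlochSeedDiscOne.HeightTower
open Summit.HodgeConjecture.HodgeConjecture.Cruxes.BlochSeedDiscOne.LeggedFloor (NullStep Supplies Detects RuleDP RuleD Disj)
open Summit.HodgeConjecture.HodgeConjecture.Cruxes.BlochSeedDiscOne.HallB136 (HallUp notDeadB weakLiveB weakLiveB_of)
open Summit.HodgeConjecture.HodgeConjecture.Cruxes.BlochSeedDiscOne.RuleDPlate
  (HallPlusUp hallUp_of_hallPlusUp hallUp_shiftD hallPlusUp_shiftD disj_shiftD ruleD_shiftD BudgetClause budgetClause_shiftD SPlusB SPlus)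
open Summit.HodgeConjecture.HodgeConjecture.Cruxes.BlochSeedDiscOne.SigmaH (sigmaH extPN extNP extNN extPP sigmaH_shiftD)
open Summit.HodgeConjecture.HodgeConjecture.Cruxes.BlochSeedDiscOne.MinMassWindowH14
  (toG rawT T_raw allB allB_iff anyB anyB_iff cellOf allWords mem_allWords efreeB efree_of_efreeB efreeB_of_efree blochB
   bloch_of_blochB degB deg_eq_degB onAlphaB onAlphabet_of_B mem_suppN_of mem_suppP_of exists_of_mem_suppN exists_of_mem_suppP
   cellEqB cellEqB_self suppliesB suppliesB_of)
open Summit.HodgeConjecture.HodgeConjecture.Cruxes.BlochSeedDiscOne.AxisPhaseTorus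
  (AxisCell AxisRoom axisRoom_mu_eq_zero_of_law omegaC posCl mem_posCl axisRoom_inhabitant_shape)
open Summit.HodgeConjecture.HodgeConjecture.Cruxes.BlochSeedDiscOne.PhaseTorus
  (PT PhaseTorusLawN phaseTorusLawN_thirteen omega14Z pos14 pos14_card)

/-! ## §1 Generic lemmas: completeness of the raw weak-arrow test, the HEAVY-HUB surplus lemma, shift-invariance of the axis room, the law `AxisLaw r` -/

/-- the raw NOT-DEAD test is complete: `notDeadB = true` gives `NotDead`. -/
theorem notDead_of_notDeadB {ℓ ℓ' : Letter} (h : notDeadB ℓ ℓ' = true) : NotDead ℓ ℓ' := by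
  simp only [notDeadB, Bool.or_eq_true, Bool.and_eq_true, decide_eq_true_eq] at h
  rcases h with ⟨⟨ha, hx⟩, hy⟩ | ⟨ha, hb⟩
  · left
    obtain ⟨a, x, y⟩ := ℓ
    obtain ⟨a', x', y'⟩ := ℓ'
    simp only at ha hx hy
    subst ha; subst hx; subst hy
    rfl
  · right
    exact ⟨ha, by simpa only [pow_two] using hb⟩

theorem weakLive_of_weakLiveB {x y : Cell} (h : weakLiveB x y = true) : WeakLive x y := by
  simp only [weakLiveB, Bool.and_eq_true] at h
  obtain ⟨⟨⟨h0, h1⟩, h2⟩, h3⟩ := h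
  intro f
  fin_cases f
  · exact notDead_of_notDeadB h0
  · exact notDead_of_notDeadB h1
  · exact notDead_of_notDeadB h2
  · exact notDead_of_notDeadB h3

/-- **HEAVY-HUB SURPLUS LEMMA**: if ONE N-entry is weakly live above every P-entry and its multiplicity is at least the total P-mass plus `k`,
then `HallPlusUp E k` (the covering list `T` of any positive-mass column set `S` contains that entry). -/
theorem hallPlusUp_of_heavy_entry (E : Design) (k : ℕ) (e : Cell × ℕ) (he : e ∈ E.N)
    (habove : ∀ cm ∈ E.P, WeakLive cm.1 e.1) (hmass : (E.P.map Prod.snd).sum + k ≤ e.2) : HallPlusUp E k := by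
  intro S hS hpos T hT hcov
  obtain ⟨cm, hcm⟩ : ∃ cm, cm ∈ S := by
    cases S with
    | nil => simp at hpos
    | cons a l => exact ⟨a, List.mem_cons_self⟩
  have heT : e ∈ T := hcov e he ⟨cm, hcm, habove cm (hS.subset hcm)⟩
  have h1 : (S.map Prod.snd).sum ≤ (E.P.map Prod.snd).sum :=
    (hS.map Prod.snd).sum_le_sum (fun a _ => Nat.zero_le a)
  have h2 : e.2 ≤ (T.map Prod.snd).sum :=
    List.single_le_sum (fun a _ => Nat.zero_le a) e.2 (List.mem_map.2 ⟨e, heT, rfl⟩)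
  omega

/-- axis cells are shift-invariant (the shift moves `a` only). -/
theorem axisCell_shiftCell (t : ℤ) (c : Cell) : AxisCell (shiftCell t c) ↔ AxisCell c := by
  simp only [AxisCell, shiftCell, Letter.isAxis, shiftL_x, shiftL_y]

/-- the axis room is shift-invariant. -/
theorem axisRoom_shiftD (t : ℤ) (E : Design) (hR : AxisRoom E) : AxisRoom (shiftD t E) := by
  intro c hc
  rw [suppN_shift, suppP_shift, ← List.map_append] at hc
  obtain ⟨c₀, hc₀, rfl⟩ := List.mem_map.mp hc
  exact (axisCell_shiftCell t c₀).mpr (hR c₀ hc₀)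

/-- **the RULE-D-free axis-room law at rank `≤ r`** (every height, no budget, no `Disj`, no `RuleD`, no `HallUp`): the sentence whose exact
threshold this file brackets to `{21, 22, 23}`. -/
def AxisLaw (r : ℤ) : Prop :=
  ∀ (h : ℤ) (D : Design), D.OnAlphabet h → AxisRoom D → D.A1 → HallPlusUp D 8 → D.rank ≤ r → D.mu = 0

theorem axisLaw_mono {r r' : ℤ} (hle : r ≤ r') (H : AxisLaw r') : AxisLaw r :=
  fun h D hD hR h1 hH8 hr => H h D hD hR h1 hH8 (hr.trans hle)

/-- `AxisLaw 21` HOLDS (g19 `axisRoom_mu_eq_zero_of_law` fed with g20 `phaseTorusLawN_thirteen`; the same term as `AxisPhaseTorus21.axisRoom_mu_eq_zero_21`). -/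
theorem axisLaw_21 : AxisLaw 21 :=
  fun _ _ hD hR h1 hH8 hr => axisRoom_mu_eq_zero_of_law hD hR h1 hH8 phaseTorusLawN_thirteen (by push_cast; omega)

/-! ## §2 The design `D⋆ = D⋆(24)` at height 14 (31 entries; N-mass 40, P-mass 16) -/

/-- N-entries of `D⋆`: `24·hub⁴` first, then the 14 positive phases of `ω₁₄` as co-level-1 axis cells with multiplicities `wt14` (mass 16). -/
def DN : List (Cell × ℕ) := [
  (cellOf ⟨14, 0, 0⟩ ⟨14, 0, 0⟩ ⟨14, 0, 0⟩ ⟨14, 0, 0⟩, 24),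
  (cellOf ⟨13, 1, 0⟩ ⟨13, 1, 0⟩ ⟨13, 0, 1⟩ ⟨13, 0, -1⟩, 1),
  (cellOf ⟨13, 1, 0⟩ ⟨13, 0, 1⟩ ⟨13, 0, -1⟩ ⟨13, 1, 0⟩, 1),
  (cellOf ⟨13, 1, 0⟩ ⟨13, 0, -1⟩ ⟨13, 1, 0⟩ ⟨13, 0, 1⟩, 2),
  (cellOf ⟨13, 0, 1⟩ ⟨13, 1, 0⟩ ⟨13, 0, 1⟩ ⟨13, -1, 0⟩, 1),
  (cellOf ⟨13, 0, 1⟩ ⟨13, 0, 1⟩ ⟨13, 1, 0⟩ ⟨13, -1, 0⟩, 1),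
  (cellOf ⟨13, 0, 1⟩ ⟨13, -1, 0⟩ ⟨13, 0, 1⟩ ⟨13, 1, 0⟩, 1),
  (cellOf ⟨13, 0, 1⟩ ⟨13, 0, -1⟩ ⟨13, -1, 0⟩ ⟨13, -1, 0⟩, 1),
  (cellOf ⟨13, -1, 0⟩ ⟨13, 1, 0⟩ ⟨13, 0, 1⟩ ⟨13, 0, 1⟩, 1),
  (cellOf ⟨13, -1, 0⟩ ⟨13, 0, 1⟩ ⟨13, -1, 0⟩ ⟨13, 0, -1⟩, 2),
  (cellOf ⟨13, -1, 0⟩ ⟨13, 0, -1⟩ ⟨13, 0, -1⟩ ⟨13, 1, 0⟩, 1),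
  (cellOf ⟨13, 0, -1⟩ ⟨13, 1, 0⟩ ⟨13, 0, -1⟩ ⟨13, -1, 0⟩, 1),
  (cellOf ⟨13, 0, -1⟩ ⟨13, -1, 0⟩ ⟨13, 1, 0⟩ ⟨13, 0, -1⟩, 1),
  (cellOf ⟨13, 0, -1⟩ ⟨13, -1, 0⟩ ⟨13, -1, 0⟩ ⟨13, 0, 1⟩, 1),
  (cellOf ⟨13, 0, -1⟩ ⟨13, -1, 0⟩ ⟨13, 0, -1⟩ ⟨13, 1, 0⟩, 1)]

/-- P-entries of `D⋆`: the 16 negative phases of `ω₁₄` as co-level-1 axis cells, multiplicity 1 each (mass 16). -/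
def DP : List (Cell × ℕ) := [
  (cellOf ⟨13, 1, 0⟩ ⟨13, 1, 0⟩ ⟨13, 1, 0⟩ ⟨13, -1, 0⟩, 1),
  (cellOf ⟨13, 1, 0⟩ ⟨13, -1, 0⟩ ⟨13, 1, 0⟩ ⟨13, 1, 0⟩, 1),
  (cellOf ⟨13, 1, 0⟩ ⟨13, -1, 0⟩ ⟨13, 0, -1⟩ ⟨13, 0, 1⟩, 1),
  (cellOf ⟨13, 1, 0⟩ ⟨13, 0, -1⟩ ⟨13, 0, 1⟩ ⟨13, -1, 0⟩, 1),
  (cellOf ⟨13, 0, 1⟩ ⟨13, 1, 0⟩ ⟨13, 1, 0⟩ ⟨13, 0, 1⟩, 1),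
  (cellOf ⟨13, 0, 1⟩ ⟨13, 1, 0⟩ ⟨13, -1, 0⟩ ⟨13, 0, -1⟩, 1),
  (cellOf ⟨13, 0, 1⟩ ⟨13, 0, 1⟩ ⟨13, 0, 1⟩ ⟨13, 0, -1⟩, 1),
  (cellOf ⟨13, 0, 1⟩ ⟨13, 0, -1⟩ ⟨13, 0, 1⟩ ⟨13, 0, 1⟩, 1),
  (cellOf ⟨13, -1, 0⟩ ⟨13, 1, 0⟩ ⟨13, -1, 0⟩ ⟨13, -1, 0⟩, 1),
  (cellOf ⟨13, -1, 0⟩ ⟨13, 0, 1⟩ ⟨13, 0, 1⟩ ⟨13, -1, 0⟩, 1),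
  (cellOf ⟨13, -1, 0⟩ ⟨13, -1, 0⟩ ⟨13, -1, 0⟩ ⟨13, 1, 0⟩, 1),
  (cellOf ⟨13, -1, 0⟩ ⟨13, -1, 0⟩ ⟨13, 0, -1⟩ ⟨13, 0, -1⟩, 1),
  (cellOf ⟨13, 0, -1⟩ ⟨13, 0, 1⟩ ⟨13, -1, 0⟩ ⟨13, 1, 0⟩, 1),
  (cellOf ⟨13, 0, -1⟩ ⟨13, 0, 1⟩ ⟨13, 0, -1⟩ ⟨13, 0, -1⟩, 1),
  (cellOf ⟨13, 0, -1⟩ ⟨13, 0, -1⟩ ⟨13, 1, 0⟩ ⟨13, 1, 0⟩, 1),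
  (cellOf ⟨13, 0, -1⟩ ⟨13, 0, -1⟩ ⟨13, 0, -1⟩ ⟨13, 0, 1⟩, 1)]

/-- `D⋆ = D⋆(24)` at height 14. -/
def Dstar : Design := ⟨DN, DP⟩

/-- the hub cell `(14;0,0)⁴`. -/
def hub4 : Cell := cellOf ⟨14, 0, 0⟩ ⟨14, 0, 0⟩ ⟨14, 0, 0⟩ ⟨14, 0, 0⟩

theorem hubE_mem : (hub4, 24) ∈ Dstar.N := List.mem_cons_self

/-- the RULE-D witness: the first charged N-cell (phases `(0,0,1,3)` = `pt14 0`). -/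
def y0 : Cell := cellOf ⟨13, 1, 0⟩ ⟨13, 1, 0⟩ ⟨13, 0, 1⟩ ⟨13, 0, -1⟩

theorem y0_mem : (y0, 1) ∈ Dstar.N := List.mem_cons_of_mem _ List.mem_cons_self

/-! ## §3 Kernel computations for `D⋆` -/

/-- one row of the class table: e-free words evaluate to `24·14^deg` (the hub part `24·exp(14H)`, word by word), every other word except the
two Bloch words vanishes. -/
def rowD (w : Word) : Bool :=
  bif efreeB w then decide (rawT DN DP w = (24 * 14 ^ degB w, 0)) else (blochB w || decide (rawT DN DP w = (0, 0)))

theorem tableD : allB allWords rowD = true := by decide +kernel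

theorem mu_rawD : rawT DN DP Word.eeee = (32, 0) := by decide +kernel

theorem EEEE_rawD : rawT DN DP Word.EEEE = (32, 0) := by decide +kernel

theorem copies_D : Dstar.copies = 56 := by decide +kernel

theorem rank_D : Dstar.rank = 24 := by decide +kernel

theorem massP_D : (Dstar.P.map Prod.snd).sum = 16 := by decide +kernel

theorem massN_D : (Dstar.N.map Prod.snd).sum = 40 := by decide +kernel

theorem alphaDN : allB DN (fun cm => onAlphaB 14 cm.1) = true := by decide +kernel

theorem alphaDP : allB DP (fun cm => onAlphaB 14 cm.1) = true := by decide +kernel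

/-- every letter of `D⋆` has level `≥ 13` (co-level `≤ 1`): used to transport `D⋆` down to every height `h ≥ 1`. -/
def levB (c : Cell) : Bool := decide (13 ≤ (c 0).a) && decide (13 ≤ (c 1).a) && decide (13 ≤ (c 2).a) && decide (13 ≤ (c 3).a)

theorem levDN : allB DN (fun cm => levB cm.1) = true := by decide +kernel

theorem levDP : allB DP (fun cm => levB cm.1) = true := by decide +kernel

theorem disjD_table : allB DN (fun cn => allB DP (fun cm => !cellEqB cm.1 cn.1)) = true := by decide +kernel

/-- raw axis test of a cell (`x·y = 0` on every factor). -/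
def axisB (c : Cell) : Bool :=
  decide ((c 0).x * (c 0).y = 0) && decide ((c 1).x * (c 1).y = 0) && decide ((c 2).x * (c 2).y = 0) && decide ((c 3).x * (c 3).y = 0)

theorem axisDN : allB DN (fun cm => axisB cm.1) = true := by decide +kernel

theorem axisDP : allB DP (fun cm => axisB cm.1) = true := by decide +kernel

/-- the hub entry is weakly live above every P-entry … -/
theorem hub_above_P : allB DP (fun cm => weakLiveB cm.1 hub4) = true := by decide +kernel

/-- … and the weakly-live N-neighbourhood of the whole P-list is that single entry (equal levels, different phases somewhere: a DEAD factor). -/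
def TD : List (Cell × ℕ) := Dstar.N.filter fun cn => anyB Dstar.P (fun cm => weakLiveB cm.1 cn.1)

theorem TD_capacity : (TD.map Prod.snd).sum = 24 ∧ TD.length = 1 := by decide +kernel

/-- no P-entry supplies the charged N-cell `y0` on the block `(0,1)` (every P-cell has the level of `y0`: no NULL step; none equals `y0` off the block). -/
theorem y0_noSupplier : allB DP (fun cm => !suppliesB cm.1 y0 (0 : Fin 4) (1 : Fin 4)) = true := by decide +kernel

/-- in fact NO charged N-entry has a supplier on ANY of its six blocks (recorded; only `y0_noSupplier` is used). -/
theorem noSupplier_all : allB DN (fun cn => cellEqB cn.1 hub4 ||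
    allB DP (fun cm => !(suppliesB cm.1 cn.1 0 1 || suppliesB cm.1 cn.1 0 2 || suppliesB cm.1 cn.1 0 3 ||
      suppliesB cm.1 cn.1 1 2 || suppliesB cm.1 cn.1 1 3 || suppliesB cm.1 cn.1 2 3))) = true := by decide +kernel

/-- Σ-H digits: no cross pair and no same-side pair of `D⋆` sits in a priced degree. -/
theorem extPN_D_one : extPN Dstar 1 = 0 := by decide +kernel
theorem extNP_D_three : extNP Dstar 3 = 0 := by decide +kernel
theorem extNN_D_two : extNN Dstar 2 = 0 := by decide +kernel
theorem extPP_D_two : extPP Dstar 2 = 0 := by decide +kernel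

/-- **the class measure of `D⋆` IS the corank-14 torus witness `ω₁₄`** (every charged cell has charge volume `V = 1`; all 256 classes, kernel). -/
theorem omegaC_D : ∀ τ : PT, omegaC Dstar τ = omega14Z τ := by decide +kernel

/-! ## §4 The certificate for `D⋆` at height 14 -/

theorem onAlphabet_D : Dstar.OnAlphabet 14 := by
  intro c hc f
  rcases List.mem_append.1 hc with hN | hP
  · obtain ⟨m, hm⟩ := exists_of_mem_suppN hN
    exact onAlphabet_of_B ((allB_iff _ _).1 alphaDN (c, m) hm) f
  · obtain ⟨m, hm⟩ := exists_of_mem_suppP hP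
    exact onAlphabet_of_B ((allB_iff _ _).1 alphaDP (c, m) hm) f

theorem axisCell_of_B {c : Cell} (hc : axisB c = true) : AxisCell c := by
  simp only [axisB, Bool.and_eq_true, decide_eq_true_eq] at hc
  obtain ⟨⟨⟨h0, h1⟩, h2⟩, h3⟩ := hc
  intro f
  fin_cases f
  · exact h0
  · exact h1
  · exact h2
  · exact h3

theorem axisRoom_D : AxisRoom Dstar := by
  intro c hc
  rcases List.mem_append.1 hc with hN | hP
  · obtain ⟨m, hm⟩ := exists_of_mem_suppN hN
    exact axisCell_of_B ((allB_iff _ _).1 axisDN (c, m) hm)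
  · obtain ⟨m, hm⟩ := exists_of_mem_suppP hP
    exact axisCell_of_B ((allB_iff _ _).1 axisDP (c, m) hm)

theorem level_of_B {c : Cell} (hc : levB c = true) : ∀ f : Fin 4, 13 ≤ (c f).a := by
  simp only [levB, Bool.and_eq_true, decide_eq_true_eq] at hc
  obtain ⟨⟨⟨h0, h1⟩, h2⟩, h3⟩ := hc
  intro f
  fin_cases f
  · exact h0
  · exact h1
  · exact h2
  · exact h3

theorem level_D : ∀ c ∈ Dstar.suppN ++ Dstar.suppP, ∀ f : Fin 4, 13 ≤ (c f).a := by
  intro c hc f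
  rcases List.mem_append.1 hc with hN | hP
  · obtain ⟨m, hm⟩ := exists_of_mem_suppN hN
    exact level_of_B ((allB_iff _ _).1 levDN (c, m) hm) f
  · obtain ⟨m, hm⟩ := exists_of_mem_suppP hP
    exact level_of_B ((allB_iff _ _).1 levDP (c, m) hm) f

theorem T_closedD (w : Word) : Dstar.T w = toG (rawT DN DP w) := T_raw Dstar w

/-- HUB ROWS: every e-free word evaluates to `24·14^{deg}` (the class of `D⋆` is `24·exp(14H) + μ·(Bloch words)`, nothing else). -/
theorem efree_rows_D (w : Word) (hw : w.efree) : Dstar.T w = ⟨24 * 14 ^ w.deg, 0⟩ := by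
  have hr := (allB_iff _ _).1 tableD w (mem_allWords w)
  unfold rowD at hr
  rw [efreeB_of_efree hw] at hr
  simp only [cond_true, decide_eq_true_eq] at hr
  rw [T_closedD, hr, deg_eq_degB]
  rfl

theorem a1_D : Dstar.A1 := by
  constructor
  · intro w hne h1 h2
    have hr := (allB_iff _ _).1 tableD w (mem_allWords w)
    unfold rowD at hr
    cases hb : efreeB w with
    | true => exact (hne (efree_of_efreeB hb)).elim
    | false =>
      rw [hb] at hr
      simp only [cond_false, Bool.or_eq_true, decide_eq_true_eq] at hr
      rcases hr with hbl | hz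
      · rcases bloch_of_blochB hbl with h | h
        · exact (h1 h).elim
        · exact (h2 h).elim
      · rw [T_closedD, hz]; ext <;> simp [toG]
  · intro w w' hw hw' hd
    rw [efree_rows_D w hw, efree_rows_D w' hw', hd]

theorem mu_D : Dstar.mu = ⟨32, 0⟩ := by
  show Dstar.T Word.eeee = _
  rw [T_closedD, mu_rawD]
  rfl

theorem mu_ne_D : Dstar.mu ≠ 0 := by
  rw [mu_D]
  decide

theorem T_EEEE_D : Dstar.T Word.EEEE = ⟨32, 0⟩ := by
  rw [T_closedD, EEEE_rawD]
  rfl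

theorem disj_D : Disj Dstar := by
  intro c hN hP
  obtain ⟨n, hn⟩ := exists_of_mem_suppN hN
  obtain ⟨m, hm⟩ := exists_of_mem_suppP hP
  have h1 := (allB_iff _ _).1 ((allB_iff _ _).1 disjD_table (c, n) hn) (c, m) hm
  rw [cellEqB_self] at h1
  exact Bool.noConfusion h1

theorem hub_above (cm : Cell × ℕ) (hcm : cm ∈ Dstar.P) : WeakLive cm.1 hub4 :=
  weakLive_of_weakLiveB ((allB_iff _ _).1 hub_above_P cm hcm)

/-- **`D⋆` satisfies PortHall₈**: the hub entry (mass 24) is weakly live above every P-entry and `16 + 8 ≤ 24`. -/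
theorem hallPlusUp8_D : HallPlusUp Dstar 8 :=
  hallPlusUp_of_heavy_entry Dstar 8 (hub4, 24) hubE_mem hub_above (by rw [massP_D])

theorem hallUp_D : HallUp Dstar := hallUp_of_hallPlusUp Dstar 8 hallPlusUp8_D

theorem TD_sublist : TD.Sublist Dstar.N := List.filter_sublist

theorem TD_covers : ∀ cn ∈ Dstar.N, (∃ cm ∈ Dstar.P, WeakLive cm.1 cn.1) → cn ∈ TD := by
  intro cn hcn hex
  obtain ⟨cm, hcm, hw⟩ := hex
  unfold TD
  exact List.mem_filter.2 ⟨hcn, (anyB_iff _ _).2 ⟨cm, hcm, weakLiveB_of hw⟩⟩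

/-- **and the surplus is TIGHT**: `¬ HallPlusUp D⋆ 9` (the whole P-list sees only the hub entry: `16 + 9 > 24`).  In the shape «`r·hub⁴` + one
level of charged cells» rank 24 is therefore the least rank carrying `ω₁₄`. -/
theorem not_hallPlusUp9_D : ¬ HallPlusUp Dstar 9 := by
  intro h
  have h1 := h Dstar.P (List.Sublist.refl _) (by rw [massP_D]; decide) TD TD_sublist TD_covers
  rw [massP_D, TD_capacity.1] at h1
  omega

theorem sigmaH_D : sigmaH Dstar = 1568 := by
  unfold sigmaH
  rw [copies_D, extPN_D_one, extNP_D_three, extNN_D_two, extPP_D_two]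
  norm_num

/-- the Σ-budget of record holds with `1008` to spare: `1568 + 28·(24 − 4) + 0 = 2128 ≤ 3136`. -/
theorem budget_D : BudgetClause sigmaH 0 Dstar := by
  unfold BudgetClause
  rw [sigmaH_D, rank_D]
  norm_num

theorem y0_suppN : y0 ∈ Dstar.suppN := mem_suppN_of y0_mem (by decide)

theorem y0_detects : Detects y0 (0 : Fin 4) (1 : Fin 4) := by
  unfold Detects y0
  decide

/-- **`D⋆` violates RULE D** (N-side clause) at the charged cell `y0`, block `(0,1)`. -/
theorem not_ruleD_D : ¬ RuleD Dstar := by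
  intro h
  obtain ⟨x, hx, hs⟩ := h.1 y0 y0_suppN (0 : Fin 4) (1 : Fin 4) (by decide) y0_detects
  obtain ⟨m, hm⟩ := exists_of_mem_suppP hx
  have hb := (allB_iff _ _).1 y0_noSupplier (x, m) hm
  rw [suppliesB_of hs] at hb
  exact Bool.noConfusion hb

/-- the positive classes of `D⋆` are the 14 positive phases of `ω₁₄`. -/
theorem posCl_D : posCl Dstar = pos14 := by
  ext τ
  rw [mem_posCl, omegaC_D τ]
  simp [pos14]

/-- the inhabitant-shape bound `#posCl + 8 ≤ rank` of `AxisPhaseTorus.axisRoom_inhabitant_shape` reads `14 + 8 = 22 ≤ 24` on `D⋆`: slack `2`. -/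
theorem posCl_card_D : (posCl Dstar).card = 14 ∧ Dstar.rank = 24 := by
  rw [posCl_D]
  exact ⟨pos14_card, rank_D⟩

/-- THE CERTIFICATE (height 14): every binder of `RuleDPlate.SPlus 14 sigmaH 0` except `RuleD`, inside the axis room, at rank 24. -/
theorem cert_D : Dstar.OnAlphabet 14 ∧ AxisRoom Dstar ∧ Disj Dstar ∧ Dstar.A1 ∧ HallUp Dstar ∧ HallPlusUp Dstar 8 ∧ Dstar.mu = ⟨32, 0⟩ ∧
    Dstar.rank = 24 ∧ Dstar.copies = 56 ∧ sigmaH Dstar = 1568 ∧ BudgetClause sigmaH 0 Dstar ∧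
    (∀ w : Word, w.efree → Dstar.T w = ⟨24 * 14 ^ w.deg, 0⟩) ∧ (∀ τ : PT, omegaC Dstar τ = omega14Z τ) ∧
    ¬ HallPlusUp Dstar 9 ∧ ¬ RuleD Dstar :=
  ⟨onAlphabet_D, axisRoom_D, disj_D, a1_D, hallUp_D, hallPlusUp8_D, mu_D, rank_D, copies_D, sigmaH_D, budget_D, efree_rows_D, omegaC_D,
    not_hallPlusUp9_D, not_ruleD_D⟩

/-! ## §5 Every height `h ≥ 1` (transport by `HeightTower.shiftD (h − 14)`), and the sentences settled -/

/-- `D⋆` transported to height `h`. -/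
def DstarAt (h : ℤ) : Design := shiftD (h - 14) Dstar

theorem onAlphabet_DstarAt {h : ℤ} (hh : 1 ≤ h) : (DstarAt h).OnAlphabet h := by
  have e : h = 14 + (h - 14) := by ring
  rw [DstarAt, e, add_sub_cancel_left]
  exact onAlphabet_shift Dstar 14 (h - 14) onAlphabet_D (fun c hc f => by have := level_D c hc f; omega)

/-- **THE INHABITANT AT EVERY HEIGHT `h ≥ 1`**: all binders of the door of record except `RuleD`, in the axis room, rank 24, 56 copies, `μ = 32`. -/
theorem cert_DstarAt {h : ℤ} (hh : 1 ≤ h) :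
    (DstarAt h).OnAlphabet h ∧ AxisRoom (DstarAt h) ∧ Disj (DstarAt h) ∧ (DstarAt h).A1 ∧ HallUp (DstarAt h) ∧
    HallPlusUp (DstarAt h) 8 ∧ (DstarAt h).mu = ⟨32, 0⟩ ∧ (DstarAt h).rank = 24 ∧ (DstarAt h).copies = 56 ∧
    BudgetClause sigmaH 0 (DstarAt h) ∧ ¬ RuleD (DstarAt h) := by
  refine ⟨onAlphabet_DstarAt hh, axisRoom_shiftD _ _ axisRoom_D, (disj_shiftD _ _).mpr disj_D, a1_shiftD _ _ a1_D,
    (hallUp_shiftD _ _).mpr hallUp_D, (hallPlusUp_shiftD _ _ 8).mpr hallPlusUp8_D, ?_, ?_, ?_, ?_, ?_⟩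
  · rw [DstarAt, mu_shiftD, mu_D]
  · rw [DstarAt, rank_shift, rank_D]
  · rw [DstarAt, copies_shift, copies_D]
  · exact (budgetClause_shiftD sigmaH 0 sigmaH_shiftD _ _).mpr budget_D
  · exact fun hr => not_ruleD_D ((ruleD_shiftD _ _).mp hr)

/-- existence form at every height `h ≥ 1`. -/
theorem exists_axisRoom_inhabitant {h : ℤ} (hh : 1 ≤ h) :
    ∃ D : Design, D.OnAlphabet h ∧ AxisRoom D ∧ Disj D ∧ D.A1 ∧ HallUp D ∧ HallPlusUp D 8 ∧ D.mu ≠ 0 ∧ D.rank = 24 ∧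
      D.copies = 56 ∧ BudgetClause sigmaH 0 D ∧ ¬ RuleD D := by
  obtain ⟨hA, hR, hd, h1, hu, hp, hμ, hr, hc, hb, hnr⟩ := cert_DstarAt hh
  exact ⟨DstarAt h, hA, hR, hd, h1, hu, hp, by rw [hμ]; decide, hr, hc, hb, hnr⟩

/-- **`AxisLaw r` FAILS for every `r ≥ 24`.** -/
theorem not_axisLaw_of_ge_24 {r : ℤ} (hr : 24 ≤ r) : ¬ AxisLaw r := by
  intro H
  have h := H 14 Dstar onAlphabet_D axisRoom_D a1_D hallPlusUp8_D (by rw [rank_D]; exact hr)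
  exact mu_ne_D h

/-- **THE THRESHOLD WINDOW of the RULE-D-free axis-room law: `21 ≤ r⋆ ≤ 23`** — true at `21` (phase torus, method ceiling `law_input_iff`),
false from `24` on (`D⋆`); `r ∈ {22, 23}` is OPEN (memo-31 §4: it needs a law-violating integer class measure with `‖ω⁻‖₁ ≤ 15` in this shape,
or a genuinely two-level design). -/
theorem axisLaw_window : AxisLaw 21 ∧ ¬ AxisLaw 24 ∧ (∀ r, 24 ≤ r → ¬ AxisLaw r) ∧ (∀ r, r ≤ 21 → AxisLaw r) :=
  ⟨axisLaw_21, not_axisLaw_of_ge_24 le_rfl, fun _ hr => not_axisLaw_of_ge_24 hr, fun _ hr => axisLaw_mono hr axisLaw_21⟩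

/-- **RULE D IS THE LOAD-BEARING BINDER OF THE AXIS-ROOM DOOR ABOVE RANK 21**: at every height `h ≥ 1` the `SPlusB`-sentence of record
with `RuleD` deleted, restricted to the axis room, is FALSE — for the Σ-budget of record `BudgetClause sigmaH 0` … -/
theorem not_ruleDfree_door_axisRoom {h : ℤ} (hh : 1 ≤ h) :
    ¬ (∀ D : Design, D.OnAlphabet h → Disj D → D.A1 → HallUp D → HallPlusUp D 8 → D.mu ≠ 0 →
        BudgetClause sigmaH 0 D → AxisRoom D → False) := by
  intro H
  obtain ⟨D, hA, hR, hd, h1, hu, hp, hμ, _, _, hb, _⟩ := exists_axisRoom_inhabitant hh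
  exact H D hA hd h1 hu hp hμ hb hR

/-- … and a fortiori budget-free, for ANY budget predicate met by the transported `D⋆`. -/
theorem not_ruleDfree_door_axisRoom_budget {h : ℤ} (hh : 1 ≤ h) (Budget : Design → Prop) (hB : Budget (DstarAt h)) :
    ¬ (∀ D : Design, D.OnAlphabet h → Disj D → D.A1 → HallUp D → HallPlusUp D 8 → D.mu ≠ 0 → Budget D → AxisRoom D → False) := by
  intro H
  obtain ⟨hA, hR, hd, h1, hu, hp, hμ, _, _, _, _⟩ := cert_DstarAt hh
  exact H (DstarAt h) hA hd h1 hu hp (by rw [hμ]; decide) hB hR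

/-- the door of record in the axis room, read through this file: whatever closes `SPlusB h Budget` on axis designs of rank `≥ 22` must USE
`RuleD` — formally, the RuleD-free sentence is refuted while the sentence of record restricted to the axis room stands open (no claim either way). -/
theorem sPlusB_axisRoom_reading {h : ℤ} (hh : 1 ≤ h) (Budget : Design → Prop) (hB : Budget (DstarAt h)) :
    (¬ ∀ D : Design, D.OnAlphabet h → Disj D → D.A1 → HallUp D → HallPlusUp D 8 → D.mu ≠ 0 → Budget D → AxisRoom D → False) ∧
    (SPlusB h Budget → ∀ D : Design, D.OnAlphabet h → Disj D → D.A1 → RuleD D → HallUp D → HallPlusUp D 8 → D.mu ≠ 0 → Budget D →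
      AxisRoom D → False) :=
  ⟨not_ruleDfree_door_axisRoom_budget hh Budget hB, fun H D hA hd h1 hr hu hp hμ hb _ => H D hA hd h1 hr hu hp hμ hb⟩

end Summit.HodgeConjecture.HodgeConjecture.Cruxes.BlochSeedDiscOne.AxisRoomInhabitant24
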